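import Mathlib
import HarnessLib
import Summits.HubbardSuperconductivity.HubbardSuperconductivity.Theorems.KLProgrammeKLRegimeSectorOverlapDefectBound
import Summits.HubbardSuperconductivity.HubbardSuperconductivity.Theorems.KLProgrammeKLRegimeSectorMultiplierFrameDiffsL1

/-!
# Route `KLProgramme` — VL child `KLRegimeVolumeLimitV17F2` (stmt-HubbardSuperconductivity-20440), closer MODEL file M2 «MISMATCH-SLICE», bracket (c),
# part 4 (closing): the `δ` of the re-sectorisation defect `E(F_{n₁}[K′])·S(F̃_{n₂}[K′]) − E(F_{n₁}[K])·S(F̃_{n₂}[K])` on one volume BY NAME from the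
# frame data — full row / column sums `≤ 54·(3/(βL²))·√W·√(16·2M·L²·N_s^Δ)·A^Δ(ε)` resp. `54·2^{n₁−n₂}·…`, `A^Δ(ε)` LINEAR in `ε ≥ max_{j≤2} coeffNorm j (K′ ⊖ K)`

Cell `gate-hubbard-kl`, seat hubbard-kl-k3c4-p2 (g11; UV / Matsubara all-U lane), ask «MISMATCH-SLICE» (= M2, bracket (c)) of the VL registrant
k3c4-p1 g11.  Part 3 (`…SectorOverlapDefectBound`, generic in the uniform thin-pair bound `T`) fed with part 2e-ii
(`…SectorMultiplierFrameDiffsL1.sum_norm_charSum_thinPairDiff_le`, the model `T`, uniform over the sector pair once the angular sizes `z₁, z₂`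
are uniform).  Hypotheses = p4's admissible-frame data for BOTH frames with a common `C²` size `A` (`hA`, `hA′`), the band bounds `B`, the cutoff
constant `d` (orders `≤ 3`), the family of angular factors `Z ω₁ a` (p4's formula) with uniform global `C²` sizes `z₁, z₂`
(`exists_angularFactor_derivBounds`, finitely many pairs), the increment `ε`, `4π ≤ zL`, the window `Λ_{n₁}β < π(2M−3)`, free rates `s₀, s₁ > 0`.
On the two volumes' top flow frames `ε = Σ_{i≤2} c_i(n⋆)/L` (`TwoPointAssembly.coeffNorm_fsub_klFlowFrameU_le_of_towerV17F2`), so `δ = O(1/L)`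
with an `L`-free constant once the consumer's rates make `√(L²·N_s)·(βL²)⁻¹·(…)` `L`-free exactly as in p3's `…AlphaWtClosed` bookkeeping.

* **`fullRowSum_overlapDefect_le_of_frames`**, **`fullColSum_overlapDefect_le_of_frames`**.

Everything is proved; no definitions, no named facts. [folklore]  References: BGM 2006 §2.5–§2.7, §3 (3.3).
-/

noncomputable section

namespace Summit.HubbardSuperconductivity.HubbardSuperconductivity.Theorems.TorusFourierL2

set_option linter.dupNamespace false -- summit = problem name (single-conjunct summit), D-0017

open Set Finset Literature.MathematicalPhysics.QuantumLattice Literature.MathematicalPhysics.QuantumLattice.BandSectorCounting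
open Literature.MathematicalPhysics.QuantumLattice.FermiRG Literature.Probability.LatticeModels Literature.Analysis.SpecialFunctions
open Summit.HubbardSuperconductivity.HubbardSuperconductivity.Theorems.DispersionFlow
open Summit.HubbardSuperconductivity.HubbardSuperconductivity.Theorems.KLRegimeSplit
open Summit.HubbardSuperconductivity.HubbardSuperconductivity.Theorems.KLProgrammeLegKernels
open Summit.HubbardSuperconductivity.HubbardSuperconductivity.Theorems.EngineV8
open Summit.HubbardSuperconductivity.HubbardSuperconductivity.Theorems.PerturbedFermiCurve
open scoped Real

section Frames

variable {L M : ℕ} [NeZero L] [NeZero M] {a b : ℝ} (B : BandBounds a b) {K K' : TrigPolyC4v} {A : ℝ}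
  (hA : ∀ p : Momentum, ∀ j ≤ 2, ‖iteratedFDeriv ℝ j (frameShift K) p‖ ≤ A)
  (hA' : ∀ p : Momentum, ∀ j ≤ 2, ‖iteratedFDeriv ℝ j (frameShift K') p‖ ≤ A) (hADt : 2 * A < B.Dtmin)
  {μ e₀ z β : ℝ} (he : 0 < e₀) (hz : 0 < z) (hz1 : z ≤ 1) (hgap : e₀ + A + z ^ 2 < -μ) (h3 : e₀ + A - μ ≤ 3)
  (hlo : a ≤ μ - A - e₀) (hhi : μ + A + e₀ ≤ b) (hβ : 0 < β) (hρA : 4 * A < 2 * B.rhomin)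
  {n₁ n₂ : ℕ} (hn : n₂ + 1 ≤ n₁)
  {d : ℝ} (hd : 0 ≤ d) (hd1 : ∀ u, |deriv (bgmCutoffSq e₀) u| ≤ d) (hd2 : ∀ u, |iteratedDeriv 2 (bgmCutoffSq e₀) u| ≤ d)
  (hd3 : ∀ u, |iteratedDeriv 3 (bgmCutoffSq e₀) u| ≤ d)
  {Z : Fin (sectorCount n₁) → Fin (sectorCount n₂) → (Fin 2 → ℝ) → ℝ}
  (hZ : ∀ (ω₁ : Fin (sectorCount n₁)) (ω₂ : Fin (sectorCount n₂)) p, Z ω₁ ω₂ p =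
    gnCutoff ((π + z) ^ 2 / π ^ 2) ((π + z) ^ 2) (p 0 ^ 2) * gnCutoff ((π + z) ^ 2 / π ^ 2) ((π + z) ^ 2) (p 1 ^ 2) *
    ((radialCutoffC (1 / 2) (momToComplex p) * sectorWeightCirc n₁ ((ω₁ : ℕ) : ℤ) (polarAngle p)) *
      (radialCutoffC (1 / 2) (momToComplex p) * sectorWeightCirc n₂ ((ω₂ : ℕ) : ℤ) (polarAngle p))))
  {z₁ z₂ : ℝ} (hZ1 : ∀ ω₁ ω₂ p, ‖fderiv ℝ (Z ω₁ ω₂) p‖ ≤ z₁) (hZ2 : ∀ ω₁ ω₂ p, ‖iteratedFDeriv ℝ 2 (Z ω₁ ω₂) p‖ ≤ z₂)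
  {ε : ℝ} (hε : ∀ j ≤ 2, (fsub K' K).coeffNorm j ≤ ε)
  (hM : klScale e₀ n₁ * β < π * (2 * M - 3)) (hzL : 2 * |2 * π / (L : ℝ)| ≤ z) {s₀ s₁ : ℝ} (hs₀ : 0 < s₀) (hs₁ : 0 < s₁)

include B hA hA' hADt he hz hz1 hgap h3 hlo hhi hβ hρA hn hd hd1 hd2 hd3 hZ hZ1 hZ2 hε hM hzL hs₀ hs₁

/-- **THE `δ` OF THE RE-SECTORISATION DEFECT, PIN-ROW FORM, FROM THE FRAME DATA** (all labels summed): `Σ_Y ‖Δ(Y′, Y)‖ ≤ 54·(1/(βL²))·(3·T(ε))`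
with `T(ε)` the model bound of `sum_norm_charSum_thinPairDiff_le` (scales `(n₁, n₂)`, `n₂ + 1 ≤ n₁`) — LINEAR in the frame increment `ε`.
[cite: BenfattoGiulianiMastropietro2006, §2.7 (2.71a); §3 (3.3)] -/
theorem fullRowSum_overlapDefect_le_of_frames (Y' : SpaceTimeIdx L M × SectorLeg (sectorCount n₁)) :
    ∑ Y : SpaceTimeIdx L M × SectorLeg (sectorCount n₂), ‖(sectorAnalysisMatrix L M β (klAnisoFamily L M β μ K' e₀ n₁) *
        sectorSubMatrix L M β (bgmFatMultiplier L M e₀ β (nambuXiCT L μ K') n₂) -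
      sectorAnalysisMatrix L M β (klAnisoFamily L M β μ K e₀ n₁) *
        sectorSubMatrix L M β (bgmFatMultiplier L M e₀ β (nambuXiCT L μ K) n₂)) Y' Y‖ ≤
      ((27 + 27 : ℕ) : ℝ) * (1 / (β * (L : ℝ) ^ 2) * (3 * (
          Real.sqrt (2048 * (1 / s₀ + 1) * (4 * ((2 * Real.sqrt 2 / s₁ + 2) * (2 * Real.sqrt 2 / s₁ + 2)) + 16 * (1 / s₁ + 1) ^ 2)) *
            Real.sqrt (16 * ((2 * M : ℕ) : ℝ) * (L : ℝ) ^ 2 *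
              (2 * ((klScale e₀ n₁ * β / π + 1) *
                ((Real.sqrt 2 * L * ((klScale e₀ n₁ + (4 + 4 * A) *
                    ((klScale e₀ n₁ + B.smax * B.Dtmin * (3 * sectorWidth n₂ / 4)) / (B.Dtmin - 2 * A)) ^ 2) / (2 * B.rhomin - 4 * A)) / π + 2) *
                  (Real.sqrt 2 * L * (2 * ((klScale e₀ n₁ + B.smax * B.Dtmin * (3 * sectorWidth n₂ / 4)) / (B.Dtmin - 2 * A))) / π + 2))))) *
            ((d * e₀ ^ 2 * 1 + 1 * (d * e₀ ^ 2)) / klScale e₀ n₁ ^ 2 * (2 * (4 + A + |μ|) * ε * 1) +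
              (4 * ((d * e₀ ^ 6 * 1 + 3 * (d * e₀ ^ 4) * (d * e₀ ^ 2) + 3 * (d * e₀ ^ 2) * (d * e₀ ^ 4) + 1 * (d * e₀ ^ 6)) / klScale e₀ n₁ ^ 2) +
                  2 * ((d * e₀ ^ 4 * 1 + 2 * (d * e₀ ^ 2) * (d * e₀ ^ 2) + 1 * (d * e₀ ^ 4)) / klScale e₀ n₁ ^ 2)) *
                (2 * π / β) ^ 2 * (2 * (4 + A + |μ|) * ε * 1) / klScale e₀ n₁ ^ 2 / (4 / (s₀ * ((2 * M : ℕ) : ℝ))) ^ 2 +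
              (2 * π / L) ^ 2 *
                (((4 * ((d * e₀ ^ 6 * 1 + 3 * (d * e₀ ^ 4) * (d * e₀ ^ 2) + 3 * (d * e₀ ^ 2) * (d * e₀ ^ 4) + 1 * (d * e₀ ^ 6)) /
                        klScale e₀ n₁ ^ 2) +
                      2 * ((d * e₀ ^ 4 * 1 + 2 * (d * e₀ ^ 2) * (d * e₀ ^ 2) + 1 * (d * e₀ ^ 4)) / klScale e₀ n₁ ^ 2)) *
                      (4 + 2 * A) ^ 2 / klScale e₀ n₁ ^ 2 +
                    2 * ((d * e₀ ^ 4 * 1 + 2 * (d * e₀ ^ 2) * (d * e₀ ^ 2) + 1 * (d * e₀ ^ 4)) / klScale e₀ n₁ ^ 2) * (4 + 4 * A) /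
                      klScale e₀ n₁) * (2 * (4 + A + |μ|) * ε * 1) +
                  4 * ((d * e₀ ^ 4 * 1 + 2 * (d * e₀ ^ 2) * (d * e₀ ^ 2) + 1 * (d * e₀ ^ 4)) / klScale e₀ n₁ ^ 2) * (4 + 2 * A) /
                      klScale e₀ n₁ * (2 * (((4 + 2 * A) * ε + (4 + A + |μ|) * (2 * ε)) * 1 + (4 + A + |μ|) * ε * z₁)) +
                  (d * e₀ ^ 2 * 1 + 1 * (d * e₀ ^ 2)) / klScale e₀ n₁ ^ 2 *
                    (2 * (((4 + 4 * A) * ε + 2 * (4 + 2 * A) * (2 * ε) + (4 + A + |μ|) * (4 * ε)) * 1 +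
                      2 * ((4 + 2 * A) * ε + (4 + A + |μ|) * (2 * ε)) * z₁ + (4 + A + |μ|) * ε * z₂))) /
                (4 / (s₁ * L)) ^ 2)))) := by
  have hn' : n₂ ≤ n₁ := by omega
  refine fullRowSum_overlapDefect_le he hβ K K' hn ?_ (fun ω₁ ω₂ => sum_norm_charSum_thinPairDiff_le B hA hA' hADt he hz hz1 hgap h3 hlo hhi
    hβ hρA hn' ω₁ ω₂ hd hd1 hd2 hd3 (hZ ω₁ ω₂) (hZ1 ω₁ ω₂) (hZ2 ω₁ ω₂) hε (fun _ => rfl) hM hzL hs₀ hs₁) Y'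
  exact le_trans (Finset.sum_nonneg fun _ _ => norm_nonneg _) (sum_norm_charSum_thinPairDiff_le B hA hA' hADt he hz hz1 hgap h3 hlo hhi
    hβ hρA hn' (⟨0, sectorCount_pos n₁⟩ : Fin (sectorCount n₁)) (⟨0, sectorCount_pos n₂⟩ : Fin (sectorCount n₂)) hd hd1 hd2 hd3
    (hZ _ _) (hZ1 _ _) (hZ2 _ _) hε (fun _ => rfl) hM hzL hs₀ hs₁)

/-- **THE `δ` OF THE RE-SECTORISATION DEFECT, COLUMN FORM, FROM THE FRAME DATA**: `Σ_{Y′} ‖Δ(Y′, Y)‖ ≤ 54·2^{n₁−n₂}·(1/(βL²))·(3·T(ε))`.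
[cite: BenfattoGiulianiMastropietro2006, §2.7 (2.71a); §3 (3.3)] -/
theorem fullColSum_overlapDefect_le_of_frames (Y : SpaceTimeIdx L M × SectorLeg (sectorCount n₂)) :
    ∑ Y' : SpaceTimeIdx L M × SectorLeg (sectorCount n₁), ‖(sectorAnalysisMatrix L M β (klAnisoFamily L M β μ K' e₀ n₁) *
        sectorSubMatrix L M β (bgmFatMultiplier L M e₀ β (nambuXiCT L μ K') n₂) -
      sectorAnalysisMatrix L M β (klAnisoFamily L M β μ K e₀ n₁) *
        sectorSubMatrix L M β (bgmFatMultiplier L M e₀ β (nambuXiCT L μ K) n₂)) Y' Y‖ ≤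
      ((27 * 2 ^ (n₁ - n₂) + 27 * 2 ^ (n₁ - n₂) : ℕ) : ℝ) * (1 / (β * (L : ℝ) ^ 2) * (3 * (
          Real.sqrt (2048 * (1 / s₀ + 1) * (4 * ((2 * Real.sqrt 2 / s₁ + 2) * (2 * Real.sqrt 2 / s₁ + 2)) + 16 * (1 / s₁ + 1) ^ 2)) *
            Real.sqrt (16 * ((2 * M : ℕ) : ℝ) * (L : ℝ) ^ 2 *
              (2 * ((klScale e₀ n₁ * β / π + 1) *
                ((Real.sqrt 2 * L * ((klScale e₀ n₁ + (4 + 4 * A) *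
                    ((klScale e₀ n₁ + B.smax * B.Dtmin * (3 * sectorWidth n₂ / 4)) / (B.Dtmin - 2 * A)) ^ 2) / (2 * B.rhomin - 4 * A)) / π + 2) *
                  (Real.sqrt 2 * L * (2 * ((klScale e₀ n₁ + B.smax * B.Dtmin * (3 * sectorWidth n₂ / 4)) / (B.Dtmin - 2 * A))) / π + 2))))) *
            ((d * e₀ ^ 2 * 1 + 1 * (d * e₀ ^ 2)) / klScale e₀ n₁ ^ 2 * (2 * (4 + A + |μ|) * ε * 1) +
              (4 * ((d * e₀ ^ 6 * 1 + 3 * (d * e₀ ^ 4) * (d * e₀ ^ 2) + 3 * (d * e₀ ^ 2) * (d * e₀ ^ 4) + 1 * (d * e₀ ^ 6)) / klScale e₀ n₁ ^ 2) +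
                  2 * ((d * e₀ ^ 4 * 1 + 2 * (d * e₀ ^ 2) * (d * e₀ ^ 2) + 1 * (d * e₀ ^ 4)) / klScale e₀ n₁ ^ 2)) *
                (2 * π / β) ^ 2 * (2 * (4 + A + |μ|) * ε * 1) / klScale e₀ n₁ ^ 2 / (4 / (s₀ * ((2 * M : ℕ) : ℝ))) ^ 2 +
              (2 * π / L) ^ 2 *
                (((4 * ((d * e₀ ^ 6 * 1 + 3 * (d * e₀ ^ 4) * (d * e₀ ^ 2) + 3 * (d * e₀ ^ 2) * (d * e₀ ^ 4) + 1 * (d * e₀ ^ 6)) /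
                        klScale e₀ n₁ ^ 2) +
                      2 * ((d * e₀ ^ 4 * 1 + 2 * (d * e₀ ^ 2) * (d * e₀ ^ 2) + 1 * (d * e₀ ^ 4)) / klScale e₀ n₁ ^ 2)) *
                      (4 + 2 * A) ^ 2 / klScale e₀ n₁ ^ 2 +
                    2 * ((d * e₀ ^ 4 * 1 + 2 * (d * e₀ ^ 2) * (d * e₀ ^ 2) + 1 * (d * e₀ ^ 4)) / klScale e₀ n₁ ^ 2) * (4 + 4 * A) /
                      klScale e₀ n₁) * (2 * (4 + A + |μ|) * ε * 1) +
                  4 * ((d * e₀ ^ 4 * 1 + 2 * (d * e₀ ^ 2) * (d * e₀ ^ 2) + 1 * (d * e₀ ^ 4)) / klScale e₀ n₁ ^ 2) * (4 + 2 * A) /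
                      klScale e₀ n₁ * (2 * (((4 + 2 * A) * ε + (4 + A + |μ|) * (2 * ε)) * 1 + (4 + A + |μ|) * ε * z₁)) +
                  (d * e₀ ^ 2 * 1 + 1 * (d * e₀ ^ 2)) / klScale e₀ n₁ ^ 2 *
                    (2 * (((4 + 4 * A) * ε + 2 * (4 + 2 * A) * (2 * ε) + (4 + A + |μ|) * (4 * ε)) * 1 +
                      2 * ((4 + 2 * A) * ε + (4 + A + |μ|) * (2 * ε)) * z₁ + (4 + A + |μ|) * ε * z₂))) /
                (4 / (s₁ * L)) ^ 2)))) := by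
  have hn' : n₂ ≤ n₁ := by omega
  refine fullColSum_overlapDefect_le he hβ K K' hn ?_ (fun ω₁ ω₂ => sum_norm_charSum_thinPairDiff_le B hA hA' hADt he hz hz1 hgap h3 hlo hhi
    hβ hρA hn' ω₁ ω₂ hd hd1 hd2 hd3 (hZ ω₁ ω₂) (hZ1 ω₁ ω₂) (hZ2 ω₁ ω₂) hε (fun _ => rfl) hM hzL hs₀ hs₁) Y
  exact le_trans (Finset.sum_nonneg fun _ _ => norm_nonneg _) (sum_norm_charSum_thinPairDiff_le B hA hA' hADt he hz hz1 hgap h3 hlo hhi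
    hβ hρA hn' (⟨0, sectorCount_pos n₁⟩ : Fin (sectorCount n₁)) (⟨0, sectorCount_pos n₂⟩ : Fin (sectorCount n₂)) hd hd1 hd2 hd3
    (hZ _ _) (hZ1 _ _) (hZ2 _ _) hε (fun _ => rfl) hM hzL hs₀ hs₁)

end Frames

end Summit.HubbardSuperconductivity.HubbardSuperconductivity.Theorems.TorusFourierL2

end
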